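import Literature.Probability.LatticeModels.TriMeshTriCells
import Literature.Probability.LatticeModels.MeshStrayParity
import HarnessLib

/-!
# Windows of a column of the sheared triangular mesh are crossed an even number of times

Topic: Probability / LatticeModels (triangular twin `TriMesh*` of the "largest mesh component =
bulk" series; sub-namespace `Literature.Probability.LatticeModels.TriMesh`; lattice coordinates:
for a Jordan domain `D` the sheared domain `Ω' = triLinear ⁻¹' D.carrier = D.triPreimage.carrier`
carries the square mesh points `meshPoint δ`, and the graph is H21's `triMeshGraph D.carrier δ`).
Fix `δ > 0`, a column `k` and a *window* `b < t` of it: the triangles `b` and `t` of column `k`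
are **not perfect** and the window is short, `δ(t - b)/2 + 8δ < η`, where `η` is a modulus of
uniform local connectedness of the exterior of `Ω'` for the radius `D₀/16`. Let `W` be a `𝕋`-walk
through mesh vertices along mesh edges whose two ends are at distance `≥ D₀/8` from the centre of
triangle `b` (with `η ≤ D₀/16`).

**Theorem** (`even_windowCrossCount`): `W` traverses the crossing edges `n` of column `k` with
`b < n ≤ t` (rungs and antidiagonals alike) an even number of times (with multiplicity).

Proof (the short loop, exactly as in `MeshStrayParity.lean` with triangles for cells). Access paths
(`exists_accessPath`) lead from the centres of the two non-perfect triangles to exterior points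
`x⁻`, `x⁺` within `4δ`; these are `< η` apart, so a path `Z` in the exterior of diameter `< D₀/8`
joins them. The loop `σ = (access⁻)⁻¹ · spine · access⁺ · Z` meets the trace of `W` only where
the vertical spine `re z = δ(k + ½)` crosses the window's crossing edges, each at its midpoint,
transversally (`crossInc_spine_kcross`): the other points of `σ` avoid the mesh. Hence the winding
number of `σ` about the mesh point of a vertex of `W` is constant along every step of `W` that is
not a window crossing edge and changes by `±1` along a window crossing edge, while it vanishes at
both ends of `W`. Parity finishes.

Folklore. Mathlib anchors: `Path`, `JoinedIn.somePath`, `SimpleGraph.Walk.darts`, `List.countP`.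
H21 anchors: `wind`, `Path.crossInc`, `crossInc_loop`, `crossInc_trans`, `crossInc_symm`,
`crossInc_eq_zero`, `wind_sub_eq_of_mem_connectedComponentIn` (`ArgumentIncrement.lean`),
`Mesh.wind_sub_eq_zero_of_subset_ball` (`MeshLoops.lean`), `TriMesh.exists_accessPath`,
`TriMesh.crossInc_spine_kcross`, `TriMesh.exists_eq_kcross_of_mem_segment` (`TriMeshTriCells.lean`),
`JordanDomain.triPreimage` (`TriMeshLattice.lean`).
-/

namespace Literature.Probability.LatticeModels.TriMesh

open Set Complex Metric Literature.Topology.PlaneTopology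
open Literature.Probability.RandomPlanarGeometry

noncomputable section

/-! ### A parity lemma along walks -/

open Classical in
/-- **Parity bookkeeping along a walk** (any graph). Let `T` be a set of edges and `w` an
integer-valued function on vertices such that along every dart of the walk `W` the value of `w`
changes by an odd amount if the edge is in `T` and not at all otherwise. Then the number of
`T`-edges traversed by `W` is even iff `w` has values of the same parity at the two ends.
[folklore] -/
theorem even_countP_iff_of_darts {V : Type*} {G : SimpleGraph V} {u v : V} (W : G.Walk u v)
    (T : Sym2 V → Prop) (w : V → ℤ)
    (hT : ∀ d ∈ W.darts, T d.edge → Odd (w d.fst - w d.snd))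
    (hnT : ∀ d ∈ W.darts, ¬ T d.edge → w d.fst = w d.snd) :
    Even (W.edges.countP fun e => decide (T e)) ↔ Even (w u - w v) := by
  induction W with
  | nil => simp
  | @cons a b c h W ih =>
    have hT' : ∀ d ∈ W.darts, T d.edge → Odd (w d.fst - w d.snd) := fun d hd =>
      hT d (by rw [SimpleGraph.Walk.darts_cons]; exact List.mem_cons_of_mem _ hd)
    have hnT' : ∀ d ∈ W.darts, ¬ T d.edge → w d.fst = w d.snd := fun d hd =>
      hnT d (by rw [SimpleGraph.Walk.darts_cons]; exact List.mem_cons_of_mem _ hd)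
    have ih' := ih hT' hnT'
    have hd0 : (⟨(a, b), h⟩ : G.Dart) ∈ (SimpleGraph.Walk.cons h W).darts := by
      rw [SimpleGraph.Walk.darts_cons]; exact List.mem_cons_self
    rw [SimpleGraph.Walk.edges_cons]
    have hsplit : w a - w c = (w a - w b) + (w b - w c) := by ring
    by_cases hab : T s(a, b)
    · have hodd : Odd (w a - w b) := hT _ hd0 hab
      have hc : List.countP (fun e => decide (T e)) (s(a, b) :: W.edges) =
          List.countP (fun e => decide (T e)) W.edges + 1 := by
        simp [hab]
      rw [hc, Nat.even_add_one, ih', hsplit, Int.even_add]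
      constructor
      · intro h1
        exact ⟨fun h2 => absurd h2 (Int.not_even_iff_odd.2 hodd), fun h2 => absurd h2 h1⟩
      · intro h1 h2
        exact Int.not_even_iff_odd.2 hodd (h1.2 h2)
    · have heq : w a = w b := hnT _ hd0 hab
      have hc : List.countP (fun e => decide (T e)) (s(a, b) :: W.edges) =
          List.countP (fun e => decide (T e)) W.edges := by
        simp [hab]
      rw [hc, ih', hsplit, heq, sub_self, zero_add]

/-! ### The main parity theorem -/

variable (D : JordanDomain)

/-- The length of the spine: `dist (kcenter t) (kcenter b) = δ(t - b)/2` for `b ≤ t`, `δ ≥ 0`.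
[folklore] -/
theorem dist_kcenter_kcenter {δ : ℝ} (hδ : 0 ≤ δ) (k : ℤ) {b t : ℤ} (hle : b ≤ t) :
    dist (kcenter δ k t) (kcenter δ k b) = δ * (t - b) / 2 := by
  rw [Complex.dist_eq]
  have : kcenter δ k t - kcenter δ k b = ((δ * (t - b) / 2 : ℝ) : ℂ) * I := by
    apply Complex.ext
    · simp
    · simp; ring
  rw [this, norm_mul, Complex.norm_I, mul_one, Complex.norm_real, Real.norm_eq_abs,
    abs_of_nonneg]
  have : (b : ℝ) ≤ t := by exact_mod_cast hle
  have : 0 ≤ δ * (t - b) := mul_nonneg hδ (by linarith)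
  linarith

open Classical in
/-- **Windows are crossed evenly.** See the module docstring. `hulc` is the uniform local
connectedness of the exterior of the sheared domain at radius `D₀/16` (from
`exterior_joinedIn_of_dist_lt` for `D.triPreimage`), the triangles `b`, `t` of column `k` are not
perfect, the window is short, and the two ends of the walk `W` (a `𝕋`-walk through mesh vertices
along mesh edges) are at distance `≥ D₀/8` from the centre of triangle `b`. Then the number of
edges of `W` among the crossing edges `b < n ≤ t` of column `k` is even. [folklore] -/
theorem even_windowCrossCount {δ D₀ η : ℝ} (hδ : 0 < δ) (hηD : η ≤ D₀ / 16)
    (hulc : ∀ x ∈ (closure (triLinear ⁻¹' D.carrier))ᶜ, ∀ y ∈ (closure (triLinear ⁻¹' D.carrier))ᶜ,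
      dist x y < η → JoinedIn ((closure (triLinear ⁻¹' D.carrier))ᶜ ∩ ball x (D₀ / 16)) x y)
    {k b t : ℤ} (hbt : b < t) (hbot : ¬ IsPerfect D.carrier δ k b)
    (htop : ¬ IsPerfect D.carrier δ k t) (hshort : δ * (t - b) / 2 + 8 * δ < η)
    {u v : Site 2} (W : triGraph.Walk u v) (hWs : ∀ a ∈ W.support, a ∈ triMeshVertices D.carrier δ)
    (hWd : ∀ d ∈ W.darts, (triMeshGraph D.carrier δ).Adj d.fst d.snd)
    (hu : D₀ / 8 ≤ dist (meshPoint δ u) (kcenter δ k b))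
    (hv : D₀ / 8 ≤ dist (meshPoint δ v) (kcenter δ k b)) :
    Even (W.edges.countP fun e => decide (∃ n, b < n ∧ n ≤ t ∧ e = kcross k n)) := by
  set Ω := D.carrier with hΩ
  have hΩo : IsOpen (triLinear ⁻¹' Ω) := D.triPreimage.isOpen
  have hJE : frontier (triLinear ⁻¹' Ω) ⊆ closure (closure (triLinear ⁻¹' Ω))ᶜ :=
    D.triPreimage.frontier_subset_closure_exterior'
  -- access paths and the exterior arc
  obtain ⟨xm, hxmE, Am, hAm, hAmd⟩ := exists_accessPath hΩo hJE hδ hbot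
  obtain ⟨xp, hxpE, Ap, hAp, hApd⟩ := exists_accessPath hΩo hJE hδ htop
  have hle : b ≤ t := hbt.le
  have hbt' : (b : ℝ) ≤ t := by exact_mod_cast hle
  have hcc : dist (kcenter δ k t) (kcenter δ k b) = δ * (t - b) / 2 := dist_kcenter_kcenter hδ.le k hle
  have hsp0 : 0 ≤ δ * ((t : ℝ) - b) / 2 := div_nonneg (mul_nonneg hδ.le (by linarith)) (by norm_num)
  have hδη : 4 * δ + δ * (t - b) / 2 < η := by linarith
  have hxdist : dist xp xm < η := by
    calc dist xp xm ≤ dist xp (kcenter δ k t) + dist (kcenter δ k t) (kcenter δ k b) +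
          dist (kcenter δ k b) xm := dist_triangle4 _ _ _ _
      _ < 4 * δ + δ * (t - b) / 2 + 4 * δ := by
          have h1 := hApd 1; have h2 := hAmd 1
          simp only [Path.target] at h1 h2
          rw [dist_comm] at h2
          linarith
      _ < η := by linarith
  set Z : Path xp xm := (hulc xp hxpE xm hxmE hxdist).somePath with hZdef
  have hZ : ∀ s, Z s ∈ (closure (triLinear ⁻¹' Ω))ᶜ ∩ ball xp (D₀ / 16) :=
    (hulc xp hxpE xm hxmE hxdist).somePath_mem
  -- the loop
  set V : Path (kcenter δ k b) (kcenter δ k t) := Path.segment (kcenter δ k b) (kcenter δ k t) with hV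
  set σ : Path xm xm := ((Am.symm.trans V).trans Ap).trans Z with hσ
  -- its range: every point avoids the mesh or lies on the spine
  have hrange : ∀ z ∈ range σ, AvoidsMesh Ω δ z ∨ z ∈ segment ℝ (kcenter δ k b) (kcenter δ k t) := by
    intro z hz
    rw [hσ, Path.trans_range, Path.trans_range, Path.trans_range, Path.symm_range, hV,
      Path.range_segment] at hz
    rcases hz with ((⟨s, rfl⟩ | hz) | ⟨s, rfl⟩) | ⟨s, rfl⟩
    · exact Or.inl (hAm s)
    · exact Or.inr hz
    · exact Or.inl (hAp s)
    · exact Or.inl (avoidsMesh_of_mem_exterior (hZ s).1)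
  -- its range lies in the ball of radius `D₀/8` about the bottom centre
  have hball : range σ ⊆ ball (kcenter δ k b) (D₀ / 8) := by
    intro z hz
    rw [hσ, Path.trans_range, Path.trans_range, Path.trans_range, Path.symm_range, hV,
      Path.range_segment] at hz
    rw [mem_ball]
    rcases hz with ((⟨s, rfl⟩ | hz) | ⟨s, rfl⟩) | ⟨s, rfl⟩
    · linarith [hAmd s]
    · have := dist_le_of_mem_spine (k := k) hle hδ.le hz
      linarith
    · calc dist (Ap s) (kcenter δ k b) ≤ dist (Ap s) (kcenter δ k t) + dist (kcenter δ k t) (kcenter δ k b) :=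
            dist_triangle _ _ _
        _ < 4 * δ + δ * (t - b) / 2 := by linarith [hApd s]
        _ < D₀ / 8 := by linarith
    · calc dist (Z s) (kcenter δ k b) ≤ dist (Z s) xp + dist xp (kcenter δ k t) +
            dist (kcenter δ k t) (kcenter δ k b) := dist_triangle4 _ _ _ _
        _ < D₀ / 16 + 4 * δ + δ * (t - b) / 2 := by
            have h1 := mem_ball.1 (hZ s).2
            have h2 := hApd 1
            simp only [Path.target] at h2
            linarith
        _ ≤ D₀ / 8 := by linarith
  -- mesh vertices are off the loop
  have hoff : ∀ a ∈ triMeshVertices Ω δ, meshPoint δ a ∉ range σ := by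
    intro a ha hmem
    rcases hrange _ hmem with h | h
    · exact h.1 a ha rfl
    · have := (re_eq_and_im_mem_of_mem_spine hle hδ.le h).1
      rw [meshPoint_re] at this
      exact Mesh.half_ne_mul_int hδ k (a 0) this.symm
  -- winding numbers about mesh points
  set w : Site 2 → ℤ := fun a => wind fun s => σ.extend s - meshPoint δ a with hw
  have hKc : IsClosed (range σ) := (isCompact_range σ.continuous).isClosed
  -- (1) along a dart that is not a window crossing edge, `w` is constant
  have hconst : ∀ d ∈ W.darts, ¬ (∃ n, b < n ∧ n ≤ t ∧ d.edge = kcross k n) → w d.fst = w d.snd := by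
    intro d hd hnot
    have ha : d.fst ∈ triMeshVertices Ω δ := hWs _ (W.dart_fst_mem_support_of_mem_darts hd)
    have hb : d.snd ∈ triMeshVertices Ω δ := hWs _ (W.dart_snd_mem_support_of_mem_darts hd)
    have hadj := hWd d hd
    -- the closed edge misses the loop
    have hmiss : segment ℝ (meshPoint δ d.fst) (meshPoint δ d.snd) ⊆ (range σ)ᶜ := by
      intro z hz hzσ
      rcases hrange z hzσ with h | h
      · exact h.2 _ ha _ hb hadj hz
      · obtain ⟨hre, h1, h2⟩ := re_eq_and_im_mem_of_mem_spine hle hδ.le h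
        obtain ⟨n, hn1, hn2, hn⟩ :=
          exists_eq_kcross_of_mem_segment hδ (triMeshGraph_adj_iff_shear.1 hadj).1 hz hre h1 h2
        exact hnot ⟨n, hn1, hn2, by rw [← hn]; rfl⟩
    have hcomp : meshPoint δ d.snd ∈ connectedComponentIn (range σ)ᶜ (meshPoint δ d.fst) :=
      (convex_segment _ _).isPreconnected.subset_connectedComponentIn (left_mem_segment ℝ _ _)
        hmiss (right_mem_segment ℝ _ _)
    exact wind_sub_eq_of_mem_connectedComponentIn σ.continuous_extend.continuousOn (by simp) hKc
      (fun s hs => by rw [Path.extend_apply σ hs]; exact mem_range_self _) hcomp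
  -- (2) across a window crossing edge, `w` jumps by one
  have hjump : ∀ n, b < n → n ≤ t →
      xL k n ∈ triMeshVertices Ω δ → xR k n ∈ triMeshVertices Ω δ →
      (triMeshGraph Ω δ).Adj (xL k n) (xR k n) →
      w (xL k n) - w (xR k n) = 1 := by
    intro n hn1 hn2 hl hr hadj
    set ℓ := meshPoint δ (xL k n) with hℓ
    set r := meshPoint δ (xR k n) with hr'
    have hℓσ : ℓ ∉ range σ := hoff _ hl
    have hrσ : r ∉ range σ := hoff _ hr
    have hrs : range σ = ((range Am ∪ segment ℝ (kcenter δ k b) (kcenter δ k t)) ∪ range Ap) ∪ range Z := by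
      rw [hσ, Path.trans_range, Path.trans_range, Path.trans_range, Path.symm_range, hV,
        Path.range_segment]
    have nAm : ℓ ∉ range Am.symm ∧ r ∉ range Am.symm := by
      rw [Path.symm_range]
      exact ⟨fun h => hℓσ (by rw [hrs]; exact Or.inl (Or.inl (Or.inl h))),
        fun h => hrσ (by rw [hrs]; exact Or.inl (Or.inl (Or.inl h)))⟩
    have nV : ℓ ∉ range V ∧ r ∉ range V := by
      rw [hV, Path.range_segment]
      exact ⟨fun h => hℓσ (by rw [hrs]; exact Or.inl (Or.inl (Or.inr h))),
        fun h => hrσ (by rw [hrs]; exact Or.inl (Or.inl (Or.inr h)))⟩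
    have nAp : ℓ ∉ range Ap ∧ r ∉ range Ap :=
      ⟨fun h => hℓσ (by rw [hrs]; exact Or.inl (Or.inr h)),
        fun h => hrσ (by rw [hrs]; exact Or.inl (Or.inr h))⟩
    have nZ : ℓ ∉ range Z ∧ r ∉ range Z :=
      ⟨fun h => hℓσ (by rw [hrs]; exact Or.inr h), fun h => hrσ (by rw [hrs]; exact Or.inr h)⟩
    have nAmV : ℓ ∉ range (Am.symm.trans V) ∧ r ∉ range (Am.symm.trans V) := by
      rw [Path.trans_range]
      exact ⟨fun h => h.elim nAm.1 nV.1, fun h => h.elim nAm.2 nV.2⟩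
    have nAmVAp : ℓ ∉ range ((Am.symm.trans V).trans Ap) ∧ r ∉ range ((Am.symm.trans V).trans Ap) := by
      rw [Path.trans_range]
      exact ⟨fun h => h.elim nAmV.1 nAp.1, fun h => h.elim nAmV.2 nAp.2⟩
    -- the pieces other than the spine avoid the closed edge
    have hseg_avoid : ∀ z, AvoidsMesh Ω δ z → z ∉ segment ℝ ℓ r := fun z hz =>
      hz.2 _ hl _ hr hadj
    have cAm : Am.symm.crossInc ℓ r = 0 :=
      Path.crossInc_eq_zero _ fun s => hseg_avoid _ (hAm (unitInterval.symm s))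
    have cAp : Ap.crossInc ℓ r = 0 := Path.crossInc_eq_zero _ fun s => hseg_avoid _ (hAp s)
    have cZ : Z.crossInc ℓ r = 0 :=
      Path.crossInc_eq_zero _ fun s => hseg_avoid _ (avoidsMesh_of_mem_exterior (hZ s).1)
    have cV : V.crossInc ℓ r = 2 * Real.pi * I := crossInc_spine_kcross hδ k hn1 hn2
    have ctot : σ.crossInc ℓ r = 2 * Real.pi * I := by
      rw [hσ, Path.crossInc_trans _ _ nAmVAp.1 nZ.1 nAmVAp.2 nZ.2,
        Path.crossInc_trans _ _ nAmV.1 nAp.1 nAmV.2 nAp.2,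
        Path.crossInc_trans _ _ nAm.1 nV.1 nAm.2 nV.2, cAm, cV, cAp, cZ]
      ring
    have hloop := Path.crossInc_loop σ hℓσ hrσ
    rw [ctot] at hloop
    have h2pi : (2 * Real.pi * I : ℂ) ≠ 0 := by
      simp [Real.pi_ne_zero, Complex.I_ne_zero]
    have : ((w (xL k n) - w (xR k n) : ℤ) : ℂ) = 1 := by
      have h1 : (1 : ℂ) * (2 * Real.pi * I) =
          ((wind fun s => σ.extend s - ℓ) - wind fun s => σ.extend s - r) * (2 * Real.pi * I) := by
        rw [one_mul]; exact hloop
      have := mul_right_cancel₀ h2pi h1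
      rw [hw]
      push_cast
      exact this.symm
    exact_mod_cast this
  -- (3) the parity lemma
  have hT : ∀ d ∈ W.darts, (∃ n, b < n ∧ n ≤ t ∧ d.edge = kcross k n) →
      Odd (w d.fst - w d.snd) := by
    rintro d hd ⟨n, hn1, hn2, hn⟩
    have ha : d.fst ∈ triMeshVertices Ω δ := hWs _ (W.dart_fst_mem_support_of_mem_darts hd)
    have hb : d.snd ∈ triMeshVertices Ω δ := hWs _ (W.dart_snd_mem_support_of_mem_darts hd)
    have hadj := hWd d hd
    have hn' : s(d.fst, d.snd) = kcross k n := hn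
    rw [kcross, Sym2.eq_iff] at hn'
    rcases hn' with ⟨h1, h2⟩ | ⟨h1, h2⟩
    · rw [h1, h2] at hadj ⊢
      rw [h1] at ha; rw [h2] at hb
      rw [hjump n hn1 hn2 ha hb hadj]
      exact odd_one
    · rw [h1, h2] at hadj ⊢
      rw [h1] at ha; rw [h2] at hb
      have := hjump n hn1 hn2 hb ha hadj.symm
      rw [show w (xR k n) - w (xL k n) = -(w (xL k n) - w (xR k n)) by ring, this]
      simp
  have hpar := even_countP_iff_of_darts W (fun e => ∃ n, b < n ∧ n ≤ t ∧ e = kcross k n) w hT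
    hconst
  rw [hpar]
  -- (4) both ends are far from the loop: winding number zero
  have hu0 : w u = 0 := Mesh.wind_sub_eq_zero_of_subset_ball σ hball hu
  have hv0 : w v = 0 := Mesh.wind_sub_eq_zero_of_subset_ball σ hball hv
  rw [hu0, hv0, sub_zero]
  exact ⟨0, rfl⟩

end

end Literature.Probability.LatticeModels.TriMesh
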